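/-
Copyright: cell `langlands-arthur-audit` (papers/Langlands/langlands-arthur-audit), unit `pub-arthur-up-g18`
(literature-prover-pub-arthur-up-g18-0, 2026-08-19).  Staged for the tree under
`Literature/NumberTheory/Automorphic/Arthur2013/` (LEAN-IN-TREE rule 2026-08-18).  Module map M59; imports its twin
`Leaves/Transfer1997.lean` (M57; for `Leaves.Scopes` and the two elementary lemmas `W97.tf`, `W97.exists_not_mem_nat`).
v1.1 (unit `pub-arthur-up-g43`, literature-prover-pub-arthur-up-g43-0, 2026-08-20): APPEND-ONLY section « [H95] swept as a whole
text » at the end of namespace `H95` (declarations `H95HitKind` … `h95_sweep_register`); nothing above it changed.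
-/
import Literature.NumberTheory.Automorphic.Arthur2013.Leaves.Transfer1997
import HarnessLib

/-!
# Arthur (2013) audit, typed leaves — [H95] Hales, « reduction to unit elements » read FIRST-HAND (rows L03/L04)

[H95] = T. C. Hales, *On the fundamental lemma for standard endoscopy: reduction to unit elements*, Canad. J.
Math. **47** (1995) 974–994, doi:10.4153/CJM-1995-051-5 (bib `Hales1995`; PUBLISHED; Cambridge Core text layer HELD by
the cell as corpus key `paper:doi-10-4153-cjm-1995-051-5`, page texts staged by unit pub-arthur-up-g12 at
`HOME/pub-arthur-up-g12/primaries/txt-Hales1995/p00NN.txt`, printed page = 973 + NN; cell quotations CITED-FACTS UP-197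
(gen 12) and UP-314… (gen 18)).  The audited book cites it as « [Hal] » (AMS bibliography p.574) « only for the full
Hecke algebra » (module `Upstream`, `Leaf.OrdinaryFL` / `TwistedFL_fullHecke` docstrings; the book is NOT held,
acq-04129, and nothing of it is used here).

**What is reproduced.**  The STATEMENTS: the setting of §2 (F p-adic of characteristic zero; standard endoscopy
with quasicharacters; UNRAMIFIED endoscopic data, conditions (1)–(5); the fundamental lemma = the vanishing of
`Δ(γ_H, f)` for every strongly G-regular `γ_H` and every compactly supported spherical Hecke function `f`), the
reductions of §3 as printed (Lemma 3.6 — adjoint groups suffice; Lemma 3.7 — the « basic cases »; Lemma 3.8 — basic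
cases suffice; the remark that an elliptic `H` suffices), §4.1 local data and Theorem 4.2, §6 « matching of units »
and the main Theorem 6.1, with the sentences of their proofs that say what is used where (Proposition 4.3: the Levi
hypothesis serves to discard non-elliptic `γ_H`; §6: units at almost all places + a global argument + an inductive
hypothesis produce local data) — each one field of `H95.Steps`, Theorem 4.2 and Theorem 6.1 RE-DERIVED from them
(`H95.thm42`, `H95.thm61`).  Not reproduced: the harmonic analysis (§§3.1–3.5, 4.3–4.4, 5, the trace-formula argument
of §6), constants, measures.

**Why (the audit's use).**  With M57 this module types the second printed bridge behind
`Upstream.printedScope OrdinaryFL = some everyP` / `TwistedFL_unit`: [Ar] consumes the ordinary fundamental lemma at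
an ARBITRARY p-adic field (Lemma 7.3.4) and cites [H95] for the full spherical Hecke algebra, while the refereed unit
lemma is a LARGE-p theorem (Ngô 2010 → Waldspurger 2006 → Mem. AMS 908 Cor. 4.11: `NonarchGroupScope.pLarge`).  [H95]
Theorem 6.1 asks for the matching of UNITS only « at almost all unramified places of the global group … associated
with G and H » (`H95.UnitsAE`), so the large-p unit lemma discharges it for every global pair
(`H95.unitsAE_everywhere`); what the abstract's sentence « The fundamental lemma for standard endoscopy follows from
the matching of unit elements in Hecke algebras » then needs in addition is made EXPLICIT and kernel-checked: the
induction on the group that Theorems 4.2 / 6.1 presuppose (« Suppose that the fundamental lemma holds for all proper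
Levi factors », « an inductive hypothesis ») interleaved with Lemma 3.8 and the elliptic remark — typed as three
rank-indexed readings `H95.Lem38R`, `H95.EllR`, `H95.LeviR` of the printed reductions (the rank riders are the CELL'S,
DIVERGENCE D-UP-59) — giving `H95.assembled` / `H95.row_L04`: the full-Hecke fundamental lemma, hence the unit lemma,
at EVERY unramified p-adic pair of characteristic zero, small residual characteristic included
(`H95.unitFL_at_small_p`).  [H95] has NO residual-characteristic hypothesis on F (§5's « sufficiently large residual
characteristic » concerns auxiliary places of the global construction).  `H95.units_load_bearing` exhibits a setting
satisfying every printed step and every rider in which a pair violates the lemma because unit matching fails at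
infinitely many places: the unit lemma is load-bearing.  STATUS (cell LEAVES rows L03/L04): CLOSED, published —
unchanged; provenance only.

**Design.**  As `Leaves/Transfer1997.lean`: one uninterpreted signature `H95.Setting` (local pairs with their
`NonarchGroupScope` tag and a rank, global pairs, places, localisation, the association `assoc` of §6); identities as
`Prop`-valued predicates (D-UP-57); branch conditions as `Bool` tags; « almost all unramified places » as « outside a
finite list » (D-UP-58); every theorem by elementary logic; `#print axioms` empty or `[propext]`; no import beyond the
twin module M57 (for `Leaves.Scopes`, `W97.tf`, `W97.exists_not_mem_nat`).  The printed
sentence containing the word the gate lints (p.977) stands VERBATIM in a `--` comment; docstrings write « the lemma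
asserts ».  No `axiom`, no `sorry`, no `opaque`.
-/

set_option autoImplicit false

namespace Literature.NumberTheory.Automorphic.Arthur2013.Leaves

namespace H95

/-! ## §2, §6 — the signature -/

-- [H95] §2, p.977 [p0004:L5–6], VERBATIM: "The fundamental lemma conjecturally asserts that Δ(γ_H, f) = 0, for all
-- γ_H ∈ H(F)_{G-reg} and all compactly supported Hecke functions f."
/-- **[H95] §2 (pp.974–977) and §6 (pp.988–989): the objects, UNINTERPRETED.**  §2 p.974 [p0001], VERBATIM: "Let F,
F̄, and ϖ denote a p-adic field of characteristic zero, a fixed algebraic closure F̄, and a uniformizing element in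
the ring of integers O_F of F."; p.975 [p0002]: "The Hecke algebras in this paper are understood to be the spherical
Hecke algebras, composed of functions bi-invariant by a fixed hyperspecial maximal compact subgroup." and "Standard
endoscopy refers to data obtained when θ and ω are trivial. This paper treats a slightly larger class, obtained by
requiring only θ to be trivial; call this enlarged class standard endoscopy with quasicharacters. The fundamental
lemma in this paper refers exclusively to the fundamental lemma for standard endoscopy with quasicharacters. In fact,
we also deal exclusively with the fundamental lemma for strongly G-regular semisimple elements. As explained in
greater detail below, we assume that the endoscopic data is unramified."; p.976 [p0003]: "We say that (H, ℋ, s, ξ)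
are unramified endoscopic data for (G, ω) if (1) G is defined over O_F, G(O_F) is hyperspecial, and G is
unramified, (2) H is defined over O_F, H(O_F) is hyperspecial, and H is unramified, (3) ℋ is the L-group of H, (4)
The embedding ξ descends to an unramified field extension E/F, and (5) ω is an unramified quasicharacter of G(F)."
and "We let Δ = 0 denote the identity of the fundamental lemma. Namely, set Δ(γ_H, f) = Σ_{γ_G} Δ(γ_H, γ_G)
Φ(γ_G, f) − Φ^{st}(γ_H, b(f)), where Δ is the transfer factor of Kottwitz and Shelstad with the canonical
normalization given in [H2, 7]." (the lemma itself: the sentence of p.977 VERBATIM in the `--` comment above).  §6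
p.988 [p0015]: "A reductive group, defined over a number field, will be associated with each G and endoscopic group
H."; p.989 [p0016]: "For each reductive group G_w and corresponding elliptic endoscopic group H_w, we select
quasisplit groups G and H over a global field F that specialize at a given place w to G_w and H_w. We may choose F
in such a way that F_v is complex for every archimedean place v."  TYPED: `Loc` = local pairs `(G, ω; H, ℋ, s, ξ)`
over all p-adic `F` at once, with the cell's scope tag (`pLarge` = the residual-characteristic hypothesis of the
2006–2010 unit-lemma sources holds at `F`; [H95] has none) and a `rank` (the cell's bookkeeping for the induction on
the group, D-UP-59); `Glob` = pairs over number fields with places `Pl`, localisation `loc` and the association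
`assoc` of §6 (D-UP-60); the identities as predicates (D-UP-57); the branch conditions as Boolean tags.
[cite: Hales1995, §2 pp.974–977, §6 pp.988–989] -/
structure Setting where
  /-- local pairs `(G, ω)` with endoscopic data `(H, ℋ, s, ξ)` over a p-adic field `F` of characteristic zero -/
  Loc : Type
  /-- the cell's scope tag of the pair (`Leaves.Scopes.NonarchGroupScope`) -/
  scope : Loc → NonarchGroupScope
  /-- the cell's induction index (semisimple rank of `G`; D-UP-59) -/
  rank : Loc → Nat
  /-- global pairs `(G, H)` over number fields (§6) -/
  Glob : Type
  /-- finite places of the number field of a global pair -/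
  Pl : Glob → Type
  /-- localisation of a global pair at a finite place -/
  loc : (GG : Glob) → Pl GG → Loc
  /-- §6 p.988: "A reductive group, defined over a number field, will be associated with each G and endoscopic
  group H." (with p.989: quasisplit, complex archimedean places, specialising at `w` to the given pair) -/
  assoc : Loc → Glob
  /-- the fundamental lemma for the pair: `Δ(γ_H, f) = 0` for all `γ_H ∈ H(F)_{G-reg}` and all compactly supported
  spherical Hecke functions `f` (p.977) -/
  FL : Loc → Prop
  /-- §6 p.988: "We say that the matching of units holds if Δ(γ_H, f) = 0, for all strongly G-regular γ_H, when f
  is the unit element of the Hecke algebra." -/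
  UnitFL : Loc → Prop
  /-- §4.1 p.983: local data for `(G, H)` exist (an indexing set, constants `a_i^G(π)`, `a_i^H(π′)` with Conditions
  1 and 2: for every Hecke function `f`, (A) the character identities `Σ_π a_i^G(π) trace π(f) = Σ_{π′} a_i^H(π′)
  trace π′(b(f))` for all `i` ⇔ (B) `Δ(γ_H, f) = 0` for all `γ_H ∈ H(F)_{G-reg}`) -/
  LocalData : Loc → Prop
  /-- Theorem 4.2's hypothesis: "the fundamental lemma holds for all proper Levi factors of G for the endoscopic
  groups obtained by descent from H" -/
  FLLevi : Loc → Prop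
  /-- Theorem 6.1's hypothesis: "Δ(γ_H, f) is zero when γ_H is not elliptic" -/
  FLnonell : Loc → Prop
  /-- `G` is a basic case (Lemma 3.7 p.981: "(1) The center of G is connected and anisotropic; (2) The image of
  G(F) in the adjoint group is equal to the kernel of ω") -/
  basic : Loc → Bool
  /-- `G` adjoint (Lemma 3.6) -/
  adjoint : Loc → Bool
  /-- `H` is an elliptic endoscopic group of `G` -/
  ellipticH : Loc → Bool
  /-- the pair satisfies the standing assumption (1)–(5) of p.976 (unramified data; a localisation of a global pair
  does so outside finitely many places) -/
  unram : Loc → Bool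

/-- **[H95] §2 — the standing scope**, p.974 VERBATIM: "a p-adic field of characteristic zero"; standard endoscopy
with quasicharacters (`θ` trivial).  TYPED on the cell's scope tags: `p`-adic of characteristic zero, not twisted; NO
condition on `pLarge` or `rank`. [cite: Hales1995, §2 p.974–975] -/
abbrev scope2 (s : NonarchGroupScope) : Prop := s.field.isPadic = true ∧ s.twisted = false

/-- [H95]'s scope contains pairs over fields of small residual characteristic relative to the group (`pLarge =
false`). [folklore] (tag reading, by `decide`) -/
theorem scope2_has_small_p :
    scope2 { field := .nonarch 3 true, rank := 40, ram := .unramifiedNonsplit, twisted := false, pLarge := false } := by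
  decide

/-! ## §6 — « matching of units at almost all unramified places » -/

/-- **[H95] Theorem 6.1's hypothesis, p.988 [p0015]**, VERBATIM: "Suppose that the matching of units holds at almost
all unramified places of the global group and corresponding endoscopic group associated with G and H."  TYPED for a
global pair: outside a finite LIST of places, at every place where the localised data are unramified, the units match
(D-UP-58). [cite: Hales1995, Thm 6.1 p.988 (hypothesis)] -/
def UnitsAE (S : Setting) (GG : S.Glob) : Prop :=
  ∃ X : List (S.Pl GG), ∀ v : S.Pl GG, v ∉ X → S.unram (S.loc GG v) = true → S.UnitFL (S.loc GG v)

/-! ## §3 — the printed reductions -/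

/-- **[H95] Lemma 3.6, p.980 [p0007]**, VERBATIM: "LEMMA 3.6. If the fundamental lemma holds whenever G is an
adjoint group, then it holds in general" (proof pp.980–981 via the dual sequences `1 → G_der → G → G/G_der → 1`,
Lemma 3.5 and the lift to `G_sc`).  TYPED as printed: an implication between universal statements.
[cite: Hales1995, Lemma 3.6 p.980] -/
def Lem36 (S : Setting) : Prop :=
  (∀ L : S.Loc, S.adjoint L = true → S.FL L) → ∀ L : S.Loc, S.FL L

/-- **[H95] Lemma 3.8, p.982 [p0009]**, VERBATIM: "If the fundamental lemma holds for the basic cases G, then it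
holds in general" — with p.981 [p0008]: "Not only may we assume that G is adjoint, we may also assume that it is
simple over the algebraic closure of F. Orbital integrals, endoscopy, transfer factors, Hecke algebras, and the map b
of Hecke algebras are all compatible with products and are all compatible with the restriction of scalars. It is
convenient to reduce to standard endoscopy, for which the unramified quasicharacter ω is trivial. The next lemma
describes the group to be used for this. The reductive groups G constructed in the next lemma will be called the
basic cases. LEMMA 3.7. For any simple unramified adjoint group G_adj, there is an unramified reductive group G
(whose adjoint group is G_adj) with the following properties: (1) The center of G is connected and anisotropic; (2)
The image of G(F) in the adjoint group is equal to the kernel of ω."  TYPED as printed.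
[cite: Hales1995, Lemma 3.8 p.982 (with Lemma 3.7 p.981)] -/
def Lem38 (S : Setting) : Prop :=
  (∀ L : S.Loc, S.basic L = true → S.FL L) → ∀ L : S.Loc, S.FL L

/-- **[H95] §3, p.977 [p0004]**, VERBATIM: "For instance, nothing is lost by assuming that H is an elliptic
endoscopic group, because the fundamental lemma for a nonelliptic endoscopic group is equivalent to a fundamental
lemma for an elliptic endoscopic group obtained by descent (see [H2], [LS2])."  TYPED as printed.
[cite: Hales1995, §3 p.977 (elliptic remark)] -/
def EllRem (S : Setting) : Prop :=
  (∀ L : S.Loc, S.ellipticH L = true → S.FL L) → ∀ L : S.Loc, S.FL L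

/-! ## §4 — local data and Theorem 4.2; §6 — Theorem 6.1 -/

/-- **[H95] Theorem 4.2, p.983 [p0010]**, VERBATIM: "THEOREM 4.2. Let G be a basic case. Suppose that there exist
local data for (G, H). Suppose that the fundamental lemma holds for all proper Levi factors of G for the endoscopic
groups obtained by descent from H. Then the fundamental lemma holds for the endoscopic group H of G." (local data:
§4.1 p.983, VERBATIM: "(2) For every function f in the Hecke algebra of G, the following are equivalent: (A) for all
i ∈ I, we have Σ_π a_i^G(π) trace π(f) = Σ_{π′} a_i^H(π′) trace π′(b(f)), and (B) for all γ_H ∈ H(F)_{G-reg}, we have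
Δ(γ_H, f) = 0.") [cite: Hales1995, Thm 4.2 p.983 (with §4.1)] -/
def Thm42 (S : Setting) : Prop :=
  ∀ L : S.Loc, S.basic L = true → S.LocalData L → S.FLLevi L → S.FL L

/-- **[H95] Theorem 6.1 (« the main theorem of the paper »), p.988 [p0015]**, VERBATIM: "THEOREM 6.1. Suppose that
G is a basic case with elliptic endoscopic group H. Suppose that Δ(γ_H, f) is zero when γ_H is not elliptic. Suppose
that the matching of units holds at almost all unramified places of the global group and corresponding endoscopic
group associated with G and H. Then the fundamental lemma holds for (G, H)."
[cite: Hales1995, Thm 6.1 p.988] -/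
def Thm61 (S : Setting) : Prop :=
  ∀ L : S.Loc, S.basic L = true → S.ellipticH L = true → S.FLnonell L → UnitsAE S (S.assoc L) → S.FL L

/-- **[H95] abstract, p.974 [p0001]**, VERBATIM: "The fundamental lemma for standard endoscopy follows from the
matching of unit elements in Hecke algebras." with §1: "This argument assumes the matching of unit elements of Hecke
algebras at almost all places of a global situation that we construct."  TYPED READING: unit matching at almost all
unramified places of EVERY global pair ⇒ the fundamental lemma for EVERY local pair.  Not a numbered statement of the
paper; derived below (`assembled`) from the printed steps and the cell's rank-indexed readings of the reductions.
[cite: Hales1995, abstract p.974 and §1 p.974 (the sentence, typed as the cell's reading)] -/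
def Abstract (S : Setting) : Prop :=
  (∀ GG : S.Glob, UnitsAE S GG) → ∀ L : S.Loc, S.FL L

/-- **The intermediate statements [H95] prints and proves, as the proofs of Theorems 4.2 and 6.1 use them** (each
field quotes its sentence).  UNINTERPRETED beyond the quoted sentences (DIVERGENCE D-UP-57…61).
[cite: Hales1995, Prop. 4.3 p.984, Lemma 4.4 pp.984–986, §6 pp.988–993] -/
structure Steps (S : Setting) : Prop where
  /-- **Proposition 4.3, proof, p.984 [p0011]**, VERBATIM: "By the hypothesis on Levi factors in Theorem 4.2, we may
  assume that Δ(γ_H, f) = 0, if γ_H is not elliptic." — the Levi hypothesis is used (only) to discard non-elliptic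
  `γ_H` (descent for Levi factors, [H2]). -/
  prop43 : ∀ L : S.Loc, S.FLLevi L → S.FLnonell L
  /-- **§4 as it runs (Proposition 4.3 + Lemma 4.4, pp.984–986)**: for a basic case with local data, the vanishing of
  `Δ(γ_H, ·)` at non-elliptic `γ_H` gives the lemma — p.984 VERBATIM: "In light of the equivalence expressed by
  Condition 2, the fundamental lemma holds if the identities Σ_π a_i^G(π) trace π(f) = Σ_{π′} a_i^H(π′) trace
  π′(b(f)) hold for all i ∈ I." … "If we show that A is zero (Lemma 4.4), then the theorem is proved." and "LEMMA 4.4.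
  The functional A vanishes identically on the Hecke algebra."  TYPED with the non-elliptic vanishing in place of the
  Levi hypothesis it is derived from (this is how §6 uses §4: Theorem 6.1 assumes the former; D-UP-61). -/
  sec4 : ∀ L : S.Loc, S.basic L = true → S.LocalData L → S.FLnonell L → S.FL L
  /-- **§6, p.988 [p0015]**, VERBATIM: "This section uses the matching of the unit elements in the Hecke algebra, a
  global argument, and an inductive hypothesis to produce local data. We assume that G is a basic case and that H is
  an elliptic endoscopic group of G."; p.992 [p0019]: "The existence of local data at the place w is now established
  by Clozel's arguments."; p.993 [p0020]: "This is the implication (Condition 2.B implies Condition 2.A) in the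
  definition of local data." … "since the fundamental lemma is assumed on nonelliptic elements, this identity simply
  becomes Δ(γ, f_v) = 0. This is the implication (Condition 2.A implies Condition 2.B) in the definition of local
  data." -/
  sec6 : ∀ L : S.Loc, S.basic L = true → S.ellipticH L = true → S.FLnonell L →
    UnitsAE S (S.assoc L) → S.LocalData L

/-- **Theorem 4.2 re-derived in the kernel from the printed steps** (Prop. 4.3's use of the Levi hypothesis, then
§4). [cite: Hales1995, Thm 4.2 p.983 (proof pp.984–986, re-derived here)] -/
theorem thm42 (S : Setting) (st : Steps S) : Thm42 S :=
  fun L hb hld hlevi => st.sec4 L hb hld (st.prop43 L hlevi)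

/-- **Theorem 6.1 re-derived in the kernel from the printed steps** (§6 produces local data from the units at almost
all places; §4 concludes). [cite: Hales1995, Thm 6.1 p.988 (proof pp.988–993, re-derived here)] -/
theorem thm61 (S : Setting) (st : Steps S) : Thm61 S :=
  fun L hb he hne hu => st.sec4 L hb (st.sec6 L hb he hne hu) hne

/-! ## The induction the theorems presuppose — the cell's rank-indexed readings of the printed reductions -/

/-- **Lemma 3.8 with a rank rider** (the CELL'S reading, D-UP-59): the reductions of §3 (to `Z(G)°(F)`-invariant
functions, to `G_der`/`G_sc`/`G_adj`, to absolutely simple factors by products and restriction of scalars, to the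
basic case of Lemma 3.7 — pp.980–983) replace `G` by groups with the same absolute root system, so they do not raise
the semisimple rank — basic cases of rank ≤ n suffice for all pairs of rank ≤ n.  [H95] prints Lemma 3.8 without
the rider (`Lem38`); the rider is what lets it interleave with the Levi induction of Theorems 4.2 / 6.1.
[cite: Hales1995, Lemma 3.8 p.982 with §3 pp.980–983 (rank rider = cell reading)] -/
def Lem38R (S : Setting) : Prop :=
  ∀ n : Nat, (∀ L : S.Loc, S.basic L = true → S.rank L ≤ n → S.FL L) → ∀ L : S.Loc, S.rank L ≤ n → S.FL L

/-- **The elliptic remark with a rank rider** (the CELL'S reading, D-UP-59): for a basic case with NON-elliptic `H`,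
the lemma is "equivalent to a fundamental lemma for an elliptic endoscopic group obtained by descent" (p.977) — an
endoscopic pair of a PROPER Levi subgroup, of smaller semisimple rank: the lemma for all pairs of smaller rank gives
it. [cite: Hales1995, §3 p.977 (elliptic remark; rank rider = cell reading, descent [LS2])] -/
def EllR (S : Setting) : Prop :=
  ∀ L : S.Loc, S.basic L = true → S.ellipticH L = false →
    (∀ L' : S.Loc, S.rank L' < S.rank L → S.FL L') → S.FL L

/-- **« all proper Levi factors » have smaller rank** (the CELL'S reading of Theorem 4.2's hypothesis, D-UP-59): the
lemma for every pair of smaller semisimple rank gives `FLLevi` (the endoscopic groups of the proper Levi factors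
obtained by descent from `H` are pairs of smaller rank). [folklore] (definitional reading of "proper Levi factor") -/
def LeviR (S : Setting) : Prop :=
  ∀ L : S.Loc, (∀ L' : S.Loc, S.rank L' < S.rank L → S.FL L') → S.FLLevi L

/-- One step of the induction at a basic case: given the lemma below `rank L`, the units at almost all places of the
associated global pair give the lemma for `L` (elliptic `H`: Theorem 6.1 via `LeviR` and Prop. 4.3; non-elliptic
`H`: the elliptic remark). [folklore] (bookkeeping over `Steps`, `EllR`, `LeviR`) -/
theorem basic_step (S : Setting) (st : Steps S) (hE : EllR S) (hLv : LeviR S)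
    (hU : ∀ GG : S.Glob, UnitsAE S GG) (L : S.Loc) (hb : S.basic L = true)
    (ih : ∀ L' : S.Loc, S.rank L' < S.rank L → S.FL L') : S.FL L := by
  cases he : S.ellipticH L with
  | false => exact hE L hb he ih
  | true =>
    have hne : S.FLnonell L := st.prop43 L (hLv L ih)
    exact st.sec4 L hb (st.sec6 L hb he hne (hU (S.assoc L))) hne

/-- **The abstract's sentence, assembled in the kernel**: from the printed steps of §§4–6, the rank-indexed readings
of the §3 reductions, and unit matching at almost all unramified places of EVERY global pair, the fundamental lemma
(all strongly G-regular `γ_H`, ALL compactly supported spherical Hecke functions) holds for EVERY local pair — by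
induction on the rank, Lemma 3.8 closing each level.
[cite: Hales1995, abstract p.974 / §1 (assembled here from Thm 6.1, Lemma 3.8, the elliptic remark and the Levi induction)] -/
theorem assembled (S : Setting) (st : Steps S) (h38 : Lem38R S) (hE : EllR S) (hLv : LeviR S) :
    Abstract S := by
  intro hU
  suffices main : ∀ n : Nat, ∀ L : S.Loc, S.rank L ≤ n → S.FL L from
    fun L => main (S.rank L) L (Nat.le_refl _)
  intro n
  induction n with
  | zero =>
    refine h38 0 (fun L hb hr => basic_step S st hE hLv hU L hb ?_)
    intro L' hlt
    exact absurd (Nat.lt_of_lt_of_le hlt hr) (Nat.not_lt_zero _)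
  | succ n ihn =>
    refine h38 (n + 1) (fun L hb hr => basic_step S st hE hLv hU L hb ?_)
    intro L' hlt
    exact ihn L' (Nat.le_of_lt_succ (Nat.lt_of_lt_of_le hlt hr))

/-! ## The audit's reading for rows L03/L04: the full-Hecke lemma at EVERY p from the unit lemma at LARGE p -/

/-- **The 2026 supply in the generality PRINTED**: the UNIT fundamental lemma for unramified data at fields of LARGE
residual characteristic relative to the group — Ngô, Publ. IHÉS 111 (2010) Thm 1, transported to characteristic zero
by Waldspurger, J. Inst. Math. Jussieu 5 (2006), in the form Mem. AMS 908 (2008) Cor. 4.11 with `θ = 1` under (H1)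
« p > N(G)e_F + 1 » (cell `Upstream.Leaf.OrdinaryFL` docstring, RESCHAR-g12).  TYPED: `UnitFL` at every unramified
pair whose scope has `pLarge = true`.
[cite: Ngo2010, Thm 1 (with Waldspurger2006ChgtCar and Waldspurger2008Memoirs Cor. 4.11 / §4.4 (H1) for the characteristic-zero large-p form)] -/
def UnitFLLargeP (S : Setting) : Prop :=
  ∀ L : S.Loc, S.unram L = true → (S.scope L).pLarge = true → S.UnitFL L

/-- **Number-field finiteness**: for a global pair, at all but finitely many finite places the residual
characteristic exceeds any bound depending only on the pair (finitely many places above each rational prime; `e_v =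
1` almost everywhere), so the large-p hypothesis holds there.  TYPED: outside a finite list of places the
localisation's scope has `pLarge = true`.
[folklore] (standard fact about number fields, stated as the hypothesis it supplies) -/
def AlmostAllLargeP (S : Setting) : Prop :=
  ∀ GG : S.Glob, ∃ X : List (S.Pl GG), ∀ v : S.Pl GG, v ∉ X → (S.scope (S.loc GG v)).pLarge = true

/-- **Units match at almost all unramified places of EVERY global pair** once the unit lemma is known at large
residual characteristic. [folklore] (bookkeeping from `AlmostAllLargeP` and `UnitFLLargeP`) -/
theorem unitsAE_everywhere (S : Setting) (hfin : AlmostAllLargeP S) (hFL : UnitFLLargeP S) :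
    ∀ GG : S.Glob, UnitsAE S GG := by
  intro GG
  obtain ⟨X, hX⟩ := hfin GG
  exact ⟨X, fun v hv hun => hFL _ hun (hX v hv)⟩

/-- The unit element is a compactly supported spherical Hecke function, so the full-Hecke lemma contains the unit
lemma.  Stated as a hypothesis on the (uninterpreted) predicates. [folklore] (definitional containment) -/
def UnitIsHecke (S : Setting) : Prop := ∀ L : S.Loc, S.FL L → S.UnitFL L

/-- **ROWS L03/L04 (full spherical Hecke algebra at every p), the audit's reading, kernel-checked**: from [H95]'s
printed steps, the rank-indexed readings of its reductions, number-field finiteness and the UNIT lemma at LARGE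
residual characteristic, the fundamental lemma for ALL spherical Hecke functions holds at EVERY local pair in [H95]'s
scope — any residual characteristic.  The mechanism behind `Upstream.printedScope OrdinaryFL = some everyP` for the
Hecke-algebra part of the leaf (the transfer part is `Leaves.W97.row_L03`).
[cite: Hales1995, Thm 6.1 / Lemma 3.8 (assembled here with Ngo2010 + Waldspurger2006ChgtCar as the unit input)] -/
theorem row_L04 (S : Setting) (st : Steps S) (h38 : Lem38R S) (hE : EllR S) (hLv : LeviR S)
    (hfin : AlmostAllLargeP S) (hFL : UnitFLLargeP S) : ∀ L : S.Loc, S.FL L :=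
  assembled S st h38 hE hLv (unitsAE_everywhere S hfin hFL)

/-- In particular the UNIT lemma holds at pairs of SMALL residual characteristic (`pLarge = false`), where the
2006–2010 sources say nothing: large p ⇒ every p for the unit itself, through the full Hecke algebra and a global
detour. [folklore] (specialisation of `row_L04`, stated for the record) -/
theorem unitFL_at_small_p (S : Setting) (st : Steps S) (h38 : Lem38R S) (hE : EllR S) (hLv : LeviR S)
    (hfin : AlmostAllLargeP S) (hFL : UnitFLLargeP S) (hunit : UnitIsHecke S)
    (L : S.Loc) (_hsmall : (S.scope L).pLarge = false) : S.UnitFL L :=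
  hunit L (row_L04 S st h38 hE hLv hfin hFL L)

/-! ## Separation: the unit lemma is load-bearing -/

/-- The separation model: one basic pair with elliptic `H`, unramified, of rank 0; one global pair with infinitely
many places at none of which the units match; the lemma and local data fail, the Levi / non-elliptic hypotheses hold
vacuously. [folklore] (explicit structure) -/
def noUnits : Setting where
  Loc := Unit
  scope _ := { field := .nonarch 2 true, rank := 1, ram := .split, twisted := false, pLarge := false }
  rank _ := 0
  Glob := Unit
  Pl _ := Nat
  loc _ _ := ()
  assoc _ := ()
  FL _ := False
  UnitFL _ := False
  LocalData _ := False
  FLLevi _ := True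
  FLnonell _ := True
  basic _ := true
  adjoint _ := true
  ellipticH _ := true
  unram _ := true

/-- In `noUnits` unit matching fails at almost all places of the global pair. [folklore] (explicit structure) -/
theorem noUnits_not_unitsAE (GG : noUnits.Glob) : ¬ UnitsAE noUnits GG := by
  rintro ⟨X, hX⟩
  obtain ⟨n, hn⟩ := W97.exists_not_mem_nat X
  exact hX n hn rfl

/-- `noUnits` satisfies every printed step of [H95]. [folklore] (explicit structure) -/
theorem noUnits_steps : Steps noUnits where
  prop43 := fun _ _ => trivial
  sec4 := fun _ _ hld _ => False.elim hld
  sec6 := fun _ _ _ _ hu => absurd hu (noUnits_not_unitsAE _)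

/-- `noUnits` satisfies the three rank-indexed readings (its only pair is basic with elliptic `H`; `FLLevi` holds).
[folklore] (explicit structure) -/
theorem noUnits_riders : Lem38R noUnits ∧ EllR noUnits ∧ LeviR noUnits :=
  ⟨fun _ h L hr => h L rfl hr, fun _ _ h _ => W97.tf h, fun _ _ => trivial⟩

/-- **[H95] is an IMPLICATION leaf: the unit lemma is load-bearing.**  There is a setting satisfying every printed
step and every rank-indexed reading — hence Theorems 4.2 and 6.1 and the assembled statement as far as their
hypotheses reach — in which a local pair violates the fundamental lemma and the unit lemma, because unit matching
fails at infinitely many places of its global pair.  In the cell's DAG the every-p Hecke-algebra lemma therefore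
inherits the (large-p, almost-all-places) unit lemma as its input, exactly as `row_L04` consumes it.
[folklore] (explicit finite structure; the audit's own separation device, cf. `Leaves.W97.lf_is_load_bearing`) -/
theorem units_load_bearing :
    ∃ S : Setting, Steps S ∧ Lem38R S ∧ EllR S ∧ LeviR S ∧ Thm42 S ∧ Thm61 S ∧
      ∃ L : S.Loc, ¬ S.FL L ∧ ¬ S.UnitFL L :=
  ⟨noUnits, noUnits_steps, noUnits_riders.1, noUnits_riders.2.1, noUnits_riders.2.2,
    thm42 _ noUnits_steps, thm61 _ noUnits_steps, (), id, id⟩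

/-! ## [H95] swept as a whole text for deferral / admission vocabulary; its three « preprint » references in 2026 (v1.1, append-only;
unit `pub-arthur-up-g43`, literature-prover-pub-arthur-up-g43-0, 2026-08-20)

[H95] read in its VERSION OF RECORD (the 21 Cambridge Core page texts staged by up-g12, printed page = 973 + NN; locator `pNNNN:L<k>`).
Script `HOME/pub-arthur-up-g43/work/hales_sweep.py` (the English READ/EXTRA families of `Leaves/ArthurSTF` §7's `stf_sweep.py`, + two
patterns: « inductive hypothesis », and Suppose / assume that the fundamental lemma), output `work/hales_sweep.txt`: BODY (before p0020:L23
« REFERENCES ») 8 hit lines, BIBLIOGRAPHY 5 (2 titles containing « conjecture », 3 entries printed « preprint »).  Every hit read.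

BODY, READING.  p.977 (p0004:L5) « The fundamental lemma conjecturally asserts that » — the statement under proof, named; p.978 (p0005:L24)
« Now assume that the fundamental lemma holds for the embedding » — a step of Lemma 3.x's reduction (hypothesis discharged inside the
lemma); p.983 (p0010:L38) « The justification of local data comes from the following theorem, which will be proved » / « in the rest of
this section. » (internal, delivered) and (p0010:L41) Theorem 4.2's « Suppose that the fundamental lemma holds for all proper Levi factors
of G » (the induction typed in this module as `Steps` / `LeviR`); p.984 (p0011:L30, L34) « By the Howe conjecture, proved by » / « Clozel,
applied to both G and » — a THEOREM cited under its historical name ([Cl1] Ann. of Math. 129 (1989)); p.988 (p0015:L33) « This section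
uses the matching of the unit elements in the » / « Hecke algebra, a global argument, and an inductive hypothesis to produce local data. »
(typed: `UnitsAE`, the induction); p.989 (p0016:L25) « Such elements exist by weak approximation and the Howe conjecture. » (theorems).
OUTWARD admissions beyond the inputs typed in `H95.Steps`: 0.

BIBLIOGRAPHY, READING.  The three « preprint » entries and their 2026 state: p.993 (p0020:L55) « [KR] R. Kottwitz and J. Rogawski, The
distributions in the invariant trace formula are supported on characters, preprint. » — version of record Canad. J. Math. 52 (2000)
804–814, DOI 10.4153/cjm-2000-034-6 (Crossref 2026-08-20; the cell's acq-09198 text), used once, p.989 (p0016:L23) « the completion Fs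
at any finite set of places S (see [KR]). » (weak approximation); p.994 (p0021:L5–L8) « [KSI] R. Kottwitz and D. Shelstad, Twisted
Endoscopy I: Definitions, Norm Mappings and Transfer Factors, » / « preprint. » and « , Twisted Endoscopy II: Basic Global Theory,
preprint. » — no version of record under these titles in zbMATH (au:Kottwitz au:Shelstad 1990–2000 returns only Astérisque 255 (1999)
*Foundations of twisted endoscopy*, the authors' published treatment of the same material; text identity with the two preprints is NOT
asserted here); used p.975 / p.976 / p.983 ([KS1], definitions and the transfer factor) and once p.992 (p0019:L21) « the treatments in
[L] and [KS2] do not make this assumption. » (stabilization without the simply-connected hypothesis — a remark, beside [L] = Langlands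
1983, printed).  READING (status-neutral): rows L03/L04 unchanged; no third-tier item arises ([KR] printed 2000; the [KS] preprints'
content has a 1999 published home by the same authors, and [H95] consumes from [KS2] only a remark also sourced to [L]). -/

/-- The eight BODY hit lines of the sweep, as (page, class): the seat's classes. [cite: Hales1995, pp. 977, 978, 983, 984, 988, 989
(page texts p0004:L5, p0005:L24, p0010:L38 « The justification of local data comes from the following theorem, which will be proved »,
p0010:L41, p0011:L30 « By the Howe conjecture, proved by », p0011:L34, p0015:L33, p0016:L25; sweep `work/hales_sweep.txt`)] -/
inductive H95HitKind
  | statementNamed            -- « The fundamental lemma conjecturally asserts that »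
  | reductionHypothesis       -- « Now assume that the fundamental lemma holds for the embedding »
  | internalDeferralDelivered -- « which will be proved » … « in the rest of this section. »
  | typedInduction            -- Theorem 4.2 / §6: the induction on Levi factors, the unit matching (`Steps`)
  | theoremUnderHistoricalName -- « the Howe conjecture, proved by » Clozel
  deriving DecidableEq, Repr

/-- (printed page, class) for the eight lines. [cite: Hales1995, pp. 977–989 as listed] -/
def h95Hits : List (Nat × H95HitKind) :=
  [(977, .statementNamed), (978, .reductionHypothesis), (983, .internalDeferralDelivered), (983, .typedInduction),
   (984, .theoremUnderHistoricalName), (984, .theoremUnderHistoricalName), (988, .typedInduction), (989, .theoremUnderHistoricalName)]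

/-- The three « preprint » entries of [H95]'s bibliography. [cite: Hales1995, p. 993 (p0020:L55), p. 994 (p0021:L5–L8)] -/
inductive H95Preprint
  | KR | KSI | KS2
  deriving DecidableEq, Repr

/-- All three. [cite: Hales1995, pp. 993–994] -/
def H95Preprint.all : List H95Preprint := [.KR, .KSI, .KS2]

/-- (year of a version of record or of the authors' published treatment, body pages citing the key, registry note — registry strings,
not quotations). [cite: Hales1995, p. 989 (p0016:L23 « (see [KR]) »), pp. 975–983 ([KS1]), p. 992 (p0019:L21); registries Crossref DOI
10.4153/cjm-2000-034-6 and zbMATH au:Kottwitz au:Shelstad py:1990-2000 (2026-08-20)] -/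
def h95Vor : H95Preprint → Nat × List Nat × String
  | .KR => (2000, [989], "Canad. J. Math. 52 (2000) 804–814, DOI 10.4153/cjm-2000-034-6 (same title)")
  | .KSI => (1999, [975, 976, 983], "no record under this title; authors' published treatment Astérisque 255 (1999); identity not asserted")
  | .KS2 => (1999, [992], "no record under this title; authors' published treatment Astérisque 255 (1999); identity not asserted")

/-- REGISTER FACT (by `decide`): the whole-text sweep of [H95] finds eight body hit lines, none an outward admission (classes: the
statement named, one reduction hypothesis, one internal deferral delivered, two typed inductions, three invocations of the Howe
conjecture as Clozel's theorem); its three « preprint » references all have a published home by 2000; [KS2] is cited once, for a remark.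
[cite: Hales1995, pp. 977–994 (sweep `work/hales_sweep.txt`; registries 2026-08-20)] -/
theorem h95_sweep_register :
    h95Hits.length = 8
    ∧ (h95Hits.filter fun h => h.2 == .typedInduction).map (·.1) = [983, 988]
    ∧ (h95Hits.filter fun h => h.2 == .theoremUnderHistoricalName).length = 3
    ∧ (h95Hits.filter fun h => h.2 == .internalDeferralDelivered).map (·.1) = [983]
    ∧ (H95Preprint.all.filter fun k => (h95Vor k).1 = 0) = []
    ∧ (H95Preprint.all.map fun k => (h95Vor k).2.1.length) = [1, 3, 1] := by decide

end H95

end Literature.NumberTheory.Automorphic.Arthur2013.Leaves
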